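import Summits.BirchSwinnertonDyer.BirchSwinnertonDyer.Theorems.CyclotomicUntwistGNineConverseOrbitPrelim
import Mathlib.NumberTheory.Cyclotomic.Gal
import HarnessLib

/-!
# No high-precision approximate root of a supercuspidal-unramified cubic in `ℚ(ζ₉)` — the Galois
# orbit argument (kernel supply for the converse of `GNineCriterion`, route `CyclotomicUntwist`,
# crux K1 stmt-BirchSwinnertonDyer-21580)

HONEST FRAMING. Helper theorems only (`--supports stmt-BirchSwinnertonDyer-21580`); nothing about
BSD. Setting: `F` a ninth cyclotomic field, `w` its place above `3`, an INTEGER cubic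
`f = x³ + Ax² + Bx + C` with `disc f = 3^v · U`, `3 ∤ U`, `v` even, potentially good
(`w(A² − 3B)³ ≤ w(disc)`), and an ALGEBRAIC INTEGER `R ∈ 𝓞 F` that is an approximate root,
`w(f(R)) ≤ exp(−N)`, `N ≥ 8v + 8`. Conclusion (`orbit_dichotomy`): EITHER `U ≡ 1 (mod 3)` (the
discriminant is a `3`-adic square: principal-series rows) OR `f` has a RATIONAL approximate root of
precision `exp(−N + 4v + 6)`. Mechanism (no local class field theory, no completion): `Gal(F/ℚ)`
preserves `w` (`…GNineConverseNine`), so the six conjugates `σR` are approximate roots; by the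
dichotomy of `…GNineConverseCubic` each `σ` either fixes the class of `R` or moves it to distance
exactly `s = exp(−v)`. If the order-`3` generator `τ` moves it, `R, τR, τ²R` are three pairwise
separated approximate roots, the discriminant is `≈ ((R−τR)(R−τ²R)(τR−τ²R))²`, and comparing
residues (`3/(ζ−1)⁶ ≡ −1`, unit squares `≡ 1`, `v` even) gives `U ≡ 1`. If `τ` fixes it, averaging
over `⟨τ⟩` and then over complex conjugation `c` (or splitting off the `c`-conjugate pair) produces
a RATIONAL approximate root. The curve-level consumer kills the rational branch by minimality /
tameness (file `…GNineConverse`).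

References: Krasner/Newton-type estimates (folklore); L. Washington, *Cyclotomic Fields* Prop. 2.3.
-/

noncomputable section

open scoped NumberField Pointwise

open IsDedekindDomain IsDedekindDomain.HeightOneSpectrum NumberField WithZero
  Literature.NumberTheory.LFunctions Summit.BirchSwinnertonDyer.Rank1Residual.Additive.LocalTransport

-- D-0017 layout: summit = sub-problem ⇒ namespace `Summit.BirchSwinnertonDyer.BirchSwinnertonDyer.…`.
set_option linter.dupNamespace false

namespace Summit.BirchSwinnertonDyer.BirchSwinnertonDyer.Theorems.GNineConverse

section Orbit

variable {F : Type} [Field F] [NumberField F] [hF : IsCyclotomicExtension {3 ^ (1 + 1)} ℚ F]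
  (w : HeightOneSpectrum (𝓞 F)) (hw : (3 : 𝓞 F) ∈ w.asIdeal)

include hw

/-- **The far case: three separated conjugate approximate roots force `U ≡ 1 (mod 3)`.** If
`τ ∈ Gal(F/ℚ)` with `τ³ = 1` moves the class of the approximate root `R ∈ 𝓞 F`
(`w(τR − R) = exp(−v)`), then `R, τR, τ²R` are pairwise separated approximate roots, the
discriminant `3^v·U` is `≈ ((R−τR)(R−τ²R)(τR−τ²R))²`, and reading residues at `w`
(`3 = (ζ−1)⁶θ`, `θ ≡ −1`, `v` even, unit squares `≡ 1`) gives `3 ∣ U − 1`. [folklore] -/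
theorem three_dvd_sub_one_of_far (A B C : ℤ) (v : ℕ) (U : ℤ) (hv : Even v)
    (hD : A ^ 2 * B ^ 2 - 4 * B ^ 3 - 4 * A ^ 3 * C - 27 * C ^ 2 + 18 * A * B * C = 3 ^ v * U)
    (R : 𝓞 F) (N : ℕ) (hN : 8 * v + 1 ≤ N)
    (hR : w.valuation F ((R : F) ^ 3 + A * (R : F) ^ 2 + B * (R : F) + C) ≤ exp (-(N : ℤ)))
    (τ : F ≃ₐ[ℚ] F) (hτ : τ ^ 3 = 1)
    (hfar : w.valuation F (τ (R : F) - R) = exp (-(v : ℤ))) : (3 : ℤ) ∣ U - 1 := by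
  haveI : Fact (Nat.Prime 3) := ⟨Nat.prime_three⟩
  set s : ℤᵐ⁰ := exp (-(v : ℤ)) with hsdef
  set ε : ℤᵐ⁰ := exp (-(N : ℤ)) with hεdef
  -- basic valuations
  have hA := GNineCriterion.val_intCast_le w A
  have hB := GNineCriterion.val_intCast_le w B
  have hC := GNineCriterion.val_intCast_le w C
  have hRi : w.valuation F (R : F) ≤ 1 := valuation_le_one w R
  have h2 : w.valuation F (2 : F) = 1 := by
    exact_mod_cast GNine.val_natCast_eq_one_of_not_dvd w hw (D := 2) (by norm_num)
  have hs1 : s ≤ 1 := by rw [hsdef, ← exp_zero, exp_le_exp]; omega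
  -- the three conjugates `x₁ = R`, `x₂ = τR`, `x₃ = τ²R`
  have hτ3 : ∀ y : F, τ (τ (τ y)) = y := fun y ↦ by
    have := congrArg (fun g : F ≃ₐ[ℚ] F ↦ g y) hτ
    simpa [pow_succ, AlgEquiv.mul_apply] using this
  set x₁ : F := (R : F) with hx₁
  set x₂ : F := τ (R : F) with hx₂
  set x₃ : F := τ (τ (R : F)) with hx₃
  have hf₂ : w.valuation F (x₂ ^ 3 + A * x₂ ^ 2 + B * x₂ + C) ≤ ε := by
    rw [hx₂, val_eval_algEquiv w hw]; exact hR
  have hf₃ : w.valuation F (x₃ ^ 3 + A * x₃ ^ 2 + B * x₃ + C) ≤ ε := by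
    rw [hx₃, val_eval_algEquiv w hw, val_eval_algEquiv w hw]; exact hR
  have hx₂i : w.valuation F x₂ ≤ 1 := by rw [hx₂, valuation_algEquiv w hw]; exact hRi
  have hx₃i : w.valuation F x₃ ≤ 1 := by
    rw [hx₃, valuation_algEquiv w hw, valuation_algEquiv w hw]; exact hRi
  have d₁₂ : w.valuation F (x₁ - x₂) = s := by
    rw [hx₁, hx₂, ← neg_sub, Valuation.map_neg, hfar]
  have d₂₃ : w.valuation F (x₂ - x₃) = s := by
    rw [hx₂, hx₃, ← map_sub, valuation_algEquiv w hw, ← neg_sub, Valuation.map_neg, hfar]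
  have d₁₃ : w.valuation F (x₁ - x₃) = s := by
    have e : x₁ - x₃ = τ (τ (τ (R : F) - R)) := by rw [map_sub, map_sub, hτ3]
    rw [e, valuation_algEquiv w hw, valuation_algEquiv w hw, hfar]
  -- approximate Vieta
  have hL7 := val_disc_sub_sq_mul_le (v := w.valuation F) (A := (A : F)) (B := (B : F)) (C := (C : F))
    hA hB hC hRi hx₂i hx₃i h2 hs1 hR hf₂ hf₃ d₁₂ d₁₃ d₂₃
  set V : F := (x₁ - x₂) * (x₁ - x₃) * (x₂ - x₃) with hVdef
  have hDF : ((A : F) ^ 2 * (B : F) ^ 2 - 4 * (B : F) ^ 3 - 4 * (A : F) ^ 3 * C - 27 * (C : F) ^ 2 +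
      18 * A * B * C) = (3 : F) ^ v * U := by exact_mod_cast congrArg (fun z : ℤ ↦ (z : F)) hD
  rw [hDF] at hL7
  -- `V` is an algebraic integer with `w(V) = s³`
  set Vi : 𝓞 F := (R - τ • R) * (R - τ • (τ • R)) * (τ • R - τ • (τ • R)) with hVi
  have hViV : (Vi : F) = V := by
    rw [hVi, hVdef, hx₁, hx₂, hx₃]; push_cast; rfl
  have hvV : w.valuation F V = exp (-(3 * (v : ℤ))) := by
    rw [hVdef, Valuation.map_mul, Valuation.map_mul, d₁₂, d₁₃, d₂₃, hsdef, ← exp_add, ← exp_add]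
    congr 1; ring
  -- the uniformiser `π = ζ − 1` and `V = π^{3v}·V₀`
  set hζ := IsCyclotomicExtension.zeta_spec (3 ^ (1 + 1)) ℚ F
  set π : 𝓞 F := hζ.toInteger - 1 with hπdef
  have hπF : (π : F) = IsCyclotomicExtension.zeta (3 ^ (1 + 1)) ℚ F - 1 := by
    rw [hπdef]; push_cast; rfl
  have hvπ : w.valuation F (π : F) = exp (-1 : ℤ) := by
    rw [hπF]; exact (GNineCriterion.placeData_nine w hw).1
  have hspan := asIdeal_eq_span_zeta_sub_one w hw
  have hVmem : Vi ∈ w.asIdeal ^ (3 * v) := by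
    rw [← intValuation_le_pow_iff_mem, ← valuation_of_algebraMap (K := F)]
    change w.valuation F (Vi : F) ≤ _
    rw [hViV, hvV]; exact le_of_eq (by push_cast; ring_nf)
  rw [hspan, Ideal.span_singleton_pow, Ideal.mem_span_singleton'] at hVmem
  obtain ⟨V₀, hV₀⟩ := hVmem
  rw [← hπdef] at hV₀
  have hVfac : V = (π : F) ^ (3 * v) * (V₀ : F) := by
    rw [← hViV, ← hV₀]; push_cast; ring
  have hπ0 : w.valuation F (π : F) ≠ 0 := by rw [hvπ]; exact exp_ne_zero
  have hvV₀ : w.valuation F (V₀ : F) = 1 := by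
    have h := hvV
    rw [hVfac, Valuation.map_mul, Valuation.map_pow, hvπ, ← exp_nsmul] at h
    have e : exp ((3 * v) • (-1 : ℤ)) = exp (-(3 * (v : ℤ))) := by
      congr 1; simp only [nsmul_eq_mul]; push_cast; ring
    rw [e] at h
    exact (mul_eq_left₀ exp_ne_zero).mp h
  -- `θ = 3/π⁶`, `3 = π⁶ θ`, `θ ≡ −1`
  have hπne : (π : F) ≠ 0 := fun h0 ↦ by rw [h0, Valuation.map_zero] at hvπ; exact exp_ne_zero hvπ.symm
  set θ : F := 3 / (π : F) ^ 6 with hθdef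
  obtain ⟨hθ1, hθu⟩ : w.valuation F (θ + 1) < 1 ∧ w.valuation F θ = 1 := by
    rw [hθdef, hπF]; exact val_three_div_pow_six_add_one_lt_one w hw
  have h3 : (3 : F) = (π : F) ^ 6 * θ := by
    rw [hθdef]; field_simp
  -- `3^v U − V² = π^{6v} (θ^v U − V₀²)`
  have hfac : (3 : F) ^ v * (U : F) - V ^ 2 = (π : F) ^ (6 * v) * (θ ^ v * U - (V₀ : F) ^ 2) := by
    rw [h3, hVfac]; ring
  -- its valuation: `exp(−6v) · w(θ^v U − V₀²) · s² ≤ ε`, hence `w(θ^v U − V₀²) ≤ exp(−N + 8v) < 1`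
  rw [hfac, Valuation.map_mul, Valuation.map_pow, hvπ, ← exp_nsmul] at hL7
  have hX : w.valuation F (θ ^ v * U - (V₀ : F) ^ 2) < 1 := by
    by_contra hge
    rw [not_lt] at hge
    have h1 : exp ((6 * v) • (-1 : ℤ)) * 1 * s ^ 2 ≤ ε :=
      le_trans (mul_le_mul' (mul_le_mul' le_rfl hge) le_rfl) hL7
    rw [mul_one, hsdef, hεdef, ← exp_nsmul, ← exp_add, exp_le_exp] at h1
    simp only [nsmul_eq_mul, Nat.cast_ofNat, Nat.cast_mul] at h1
    omega
  -- `θ^v ≡ 1` (`v` even, `θ ≡ −1`)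
  have hθv : w.valuation F (θ ^ v - 1) < 1 := by
    obtain ⟨k, hk⟩ := hv
    have e : θ ^ v = (θ ^ 2) ^ k := by rw [hk, ← two_mul, pow_mul]
    rw [e]
    refine val_pow_sub_one_lt_one w (by rw [Valuation.map_pow, hθu, one_pow]) ?_ k
    have e2 : θ ^ 2 - 1 = (θ + 1) * (θ - 1) := by ring
    rw [e2, Valuation.map_mul]
    exact mul_lt_one_of_lt_of_le hθ1 (Valuation.map_sub_le _ hθu.le (by rw [Valuation.map_one]))
  -- `V₀² ≡ 1`
  have hV₀sq : w.valuation F ((V₀ : F) ^ 2 - 1) < 1 := val_sq_sub_one_lt_one w hw hvV₀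
  -- hence `U ≡ 1`
  have hUle : w.valuation F (U : F) ≤ 1 := GNineCriterion.val_intCast_le w U
  have hU1 : w.valuation F ((U : F) - 1) < 1 := by
    have e : (U : F) - 1 = (θ ^ v * U - (V₀ : F) ^ 2) - (θ ^ v - 1) * U + ((V₀ : F) ^ 2 - 1) := by ring
    rw [e]
    refine Valuation.map_add_lt _ (lt_of_le_of_lt (Valuation.map_sub _ _ _) (max_lt hX ?_)) hV₀sq
    rw [Valuation.map_mul]; exact mul_lt_one_of_lt_of_le hθv hUle
  by_contra hnd
  have h1 := GNine.val_intCast_eq_one_of_not_dvd w hw hnd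
  push_cast at h1
  rw [h1] at hU1
  exact lt_irrefl _ hU1

/-- **The close case: averaging over `Gal(F/ℚ)` produces a RATIONAL approximate root.** If the
order-`3` generator `τ` fixes the class of the approximate root `R ∈ 𝓞 F`
(`w(τR − R)·s² ≤ ε`), then `R₁ = (R + τR + τ²R)/3` is a `τ`-fixed approximate root; either complex
conjugation `c` also fixes its class — then `(R₁ + cR₁)/2 ∈ ℚ` is an approximate root — or
`R₁, cR₁` are separated and the third root `−A − R₁ − cR₁ ∈ ℚ` of the monic cubic is one.
Precision loss: `exp(4v + 6)`. [folklore] -/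
theorem exists_rat_approx_root_of_close (A B C : ℤ) (v : ℕ) (U : ℤ) (hU : ¬ (3 : ℤ) ∣ U)
    (hD : A ^ 2 * B ^ 2 - 4 * B ^ 3 - 4 * A ^ 3 * C - 27 * C ^ 2 + 18 * A * B * C = 3 ^ v * U)
    (hpg : w.valuation F (((A ^ 2 - 3 * B : ℤ) : F)) ^ 3 ≤ w.valuation F ((3 : F) ^ v * U))
    (R : 𝓞 F) (N : ℕ) (hN : 8 * v + 8 ≤ N)
    (hR : w.valuation F ((R : F) ^ 3 + A * (R : F) ^ 2 + B * (R : F) + C) ≤ exp (-(N : ℤ)))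
    (τ c : F ≃ₐ[ℚ] F) (hτ : τ ^ 3 = 1) (hc : c ^ 2 = 1) (hτc : τ * c = c * τ)
    (hfix : ∀ x : F, τ x = x → c x = x → x ∈ Set.range (algebraMap ℚ F))
    (hclose : w.valuation F (τ (R : F) - R) * exp (-(v : ℤ)) ^ 2 ≤ exp (-(N : ℤ))) :
    ∃ S : ℚ, w.valuation F ((S : F) ^ 3 + A * (S : F) ^ 2 + B * (S : F) + C) ≤
      exp (-(N : ℤ) + 4 * v + 6) := by
  haveI : Fact (Nat.Prime 3) := ⟨Nat.prime_three⟩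
  set s : ℤᵐ⁰ := exp (-(v : ℤ)) with hsdef
  have hs2 : s ^ 2 = exp (-(2 * (v : ℤ))) := by rw [hsdef, ← exp_nsmul]; congr 1; ring
  -- basic valuations
  have hA := GNineCriterion.val_intCast_le w A
  have hB := GNineCriterion.val_intCast_le w B
  have hC := GNineCriterion.val_intCast_le w C
  have hRi : w.valuation F (R : F) ≤ 1 := valuation_le_one w R
  have h2 : w.valuation F (2 : F) = 1 := by
    exact_mod_cast GNine.val_natCast_eq_one_of_not_dvd w hw (D := 2) (by norm_num)
  obtain ⟨-, h3, -⟩ := GNineCriterion.placeData_nine w hw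
  have hDF : ((A : F) ^ 2 * (B : F) ^ 2 - 4 * (B : F) ^ 3 - 4 * (A : F) ^ 3 * C - 27 * (C : F) ^ 2 +
      18 * A * B * C) = (3 : F) ^ v * U := by exact_mod_cast congrArg (fun z : ℤ ↦ (z : F)) hD
  have hvD : w.valuation F ((3 : F) ^ v * U) = exp (-(6 * (v : ℤ))) := by
    rw [Valuation.map_mul, val_three_pow w hw, GNine.val_intCast_eq_one_of_not_dvd w hw hU, mul_one]
  have hpg' : w.valuation F ((A : F) ^ 2 - 3 * B) ^ 3 ≤ w.valuation F ((A : F) ^ 2 * (B : F) ^ 2 -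
      4 * (B : F) ^ 3 - 4 * (A : F) ^ 3 * C - 27 * (C : F) ^ 2 + 18 * A * B * C) := by
    rw [hDF]; push_cast at hpg; exact hpg
  -- derivative data at any integral approximate root of precision `< w(D)`
  have hderiv : ∀ {X : F}, w.valuation F X ≤ 1 →
      w.valuation F (X ^ 3 + A * X ^ 2 + B * X + C) < exp (-(6 * (v : ℤ))) →
      w.valuation F (3 * X ^ 2 + 2 * A * X + B) = s ^ 2 ∧ w.valuation F (3 * X + A) ≤ s := by
    intro X hX hfX
    have hfX' : w.valuation F (X ^ 3 + A * X ^ 2 + B * X + C) < w.valuation F ((A : F) ^ 2 *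
        (B : F) ^ 2 - 4 * (B : F) ^ 3 - 4 * (A : F) ^ 3 * C - 27 * (C : F) ^ 2 + 18 * A * B * C) := by
      rw [hDF, hvD]; exact hfX
    obtain ⟨h1, -, h3⟩ := val_deriv_pow_three_eq (v := w.valuation F) hA hB hC hX h2 hpg' hfX'
    rw [hDF, hvD] at h1
    have hb := eq_exp_of_pow_three_eq h1
    refine ⟨by rw [hb, hs2], ?_⟩
    rw [hb] at h3; rw [hsdef]; exact le_exp_of_sq_le h3
  -- Galois facts
  have hτ3 : ∀ y : F, τ (τ (τ y)) = y := fun y ↦ by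
    have := congrArg (fun g : F ≃ₐ[ℚ] F ↦ g y) hτ
    simpa [pow_succ, AlgEquiv.mul_apply] using this
  have hc2 : ∀ y : F, c (c y) = y := fun y ↦ by
    have := congrArg (fun g : F ≃ₐ[ℚ] F ↦ g y) hc
    simpa [pow_succ, AlgEquiv.mul_apply] using this
  have hτc' : ∀ y : F, τ (c y) = c (τ y) := fun y ↦ by
    have := congrArg (fun g : F ≃ₐ[ℚ] F ↦ g y) hτc
    simpa [AlgEquiv.mul_apply] using this
  -- Step 1: `R₁ = (R + τR + τ²R)/3`
  set R₁ : F := ((R : F) + τ (R : F) + τ (τ (R : F))) / 3 with hR₁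
  have hτR₁ : τ R₁ = R₁ := by
    rw [hR₁, map_div₀, map_add, map_add, hτ3, map_ofNat]; ring
  have hclose2 : w.valuation F (τ (τ (R : F)) - R) * s ^ 2 ≤ exp (-(N : ℤ)) := by
    have e : τ (τ (R : F)) - R = τ (τ (R : F) - R) + (τ (R : F) - R) := by rw [map_sub]; ring
    rw [e]
    refine val_add_mul_le (v := w.valuation F) ?_ hclose
    rw [valuation_algEquiv w hw]; exact hclose
  have hR₁R : w.valuation F (R₁ - R) * s ^ 2 ≤ exp (-(N : ℤ) + 6) := by
    have e : R₁ - R = ((τ (R : F) - R) + (τ (τ (R : F)) - R)) * (3 : F)⁻¹ := by rw [hR₁]; ring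
    rw [e, Valuation.map_mul, Valuation.map_inv, h3, ← exp_neg, neg_neg, mul_right_comm, exp_add]
    exact mul_le_mul' (val_add_mul_le (v := w.valuation F) hclose hclose2) le_rfl
  have hN' : -(N : ℤ) + 6 + 2 * v ≤ 0 := by omega
  have hR₁R' : w.valuation F (R₁ - R) * exp (-(2 * (v : ℤ))) ≤ exp (-(N : ℤ) + 6) := by
    rw [← hs2]; exact hR₁R
  have hR₁Rle : w.valuation F (R₁ - R) ≤ exp (-(N : ℤ) + 2 * v + 6) := by
    refine (le_mul_exp_of_mul_exp_neg_le hR₁R').trans ?_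
    rw [← exp_add, exp_le_exp]; omega
  have hR₁i : w.valuation F R₁ ≤ 1 := by
    have h1 : w.valuation F (R₁ - R) ≤ 1 := by
      refine hR₁Rle.trans ?_
      rw [← exp_zero, exp_le_exp]; omega
    have e : R₁ = (R₁ - R) + R := by ring
    rw [e]; exact Valuation.map_add_le _ h1 hRi
  have hfR₁ : w.valuation F (R₁ ^ 3 + A * R₁ ^ 2 + B * R₁ + C) ≤ exp (-(N : ℤ) + 2 * v + 6) := by
    refine (val_eval_le_max w A B C hRi hR₁i).trans (max_le (hR.trans ?_) hR₁Rle)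
    rw [exp_le_exp]; omega
  -- Step 2: derivative data at `R₁`, dichotomy with the conjugate `cR₁`
  have hε₁D : exp (-(N : ℤ) + 2 * v + 6) < exp (-(6 * (v : ℤ))) := by rw [exp_lt_exp]; omega
  obtain ⟨hb₁, ha₁⟩ := hderiv hR₁i (lt_of_le_of_lt hfR₁ hε₁D)
  have hfcR₁ : w.valuation F ((c R₁) ^ 3 + A * (c R₁) ^ 2 + B * (c R₁) + C) ≤
      exp (-(N : ℤ) + 2 * v + 6) := by rw [val_eval_algEquiv w hw]; exact hfR₁
  have hε₁s : exp (-(N : ℤ) + 2 * v + 6) < s ^ 3 := by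
    rw [hsdef, ← exp_nsmul, exp_lt_exp]; simp only [nsmul_eq_mul, Nat.cast_ofNat]; omega
  have hcR₁i : w.valuation F (c R₁) ≤ 1 := by rw [valuation_algEquiv w hw]; exact hR₁i
  rcases dichotomy (v := w.valuation F) hb₁ ha₁ hfR₁ hfcR₁ hε₁s with hsep | hnear
  · -- Sub-case (b): `R₁, cR₁` separated — the third root `−A − (R₁ + cR₁)` is rational
    set pp : F := R₁ + c R₁ with hpp
    set mm : F := R₁ * c R₁ with hmm
    have hcp : c pp = pp := by rw [hpp, map_add, hc2]; ring
    have hcm : c mm = mm := by rw [hmm, map_mul, hc2]; ring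
    have hτp : τ pp = pp := by rw [hpp, map_add, hτc', hτR₁]
    have hτm : τ mm = mm := by rw [hmm, map_mul, hτc', hτR₁]
    obtain ⟨p', hp'⟩ := hfix pp hτp hcp
    obtain ⟨m', hm'⟩ := hfix mm hτm hcm
    refine ⟨-(A : ℚ) - p', ?_⟩
    set S : F := ((-(A : ℚ) - p' : ℚ) : F) with hSdef
    have hS : S = -(A : F) - pp := by rw [hSdef, ← hp']; push_cast; rfl
    -- `f = (x² − pp·x + mm)(x + A + pp) + r₁ x + r₀`
    set r₁ : F := (B : F) - mm + pp * A + pp ^ 2 with hr₁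
    set r₀ : F := (C : F) - mm * (A + pp) with hr₀
    have hdiv : ∀ x : F, x ^ 3 + A * x ^ 2 + B * x + C =
        (x ^ 2 - pp * x + mm) * (x + A + pp) + (r₁ * x + r₀) := fun x ↦ by rw [hr₁, hr₀]; ring
    have hg₁ : R₁ ^ 2 - pp * R₁ + mm = 0 := by rw [hpp, hmm]; ring
    have hg₂ : (c R₁) ^ 2 - pp * (c R₁) + mm = 0 := by rw [hpp, hmm]; ring
    have hf₁ : R₁ ^ 3 + A * R₁ ^ 2 + B * R₁ + C = r₁ * R₁ + r₀ := by rw [hdiv, hg₁, zero_mul, zero_add]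
    have hf₂ : (c R₁) ^ 3 + A * (c R₁) ^ 2 + B * (c R₁) + C = r₁ * (c R₁) + r₀ := by
      rw [hdiv, hg₂, zero_mul, zero_add]
    have hfS : S ^ 3 + A * S ^ 2 + B * S + C = r₁ * S + r₀ := by
      rw [hdiv, show S + A + pp = 0 by rw [hS]; ring, mul_zero, zero_add]
    -- `w(r₁)·s ≤ ε₁`, `w(r₀) ≤ max`
    have hr₁v : w.valuation F r₁ * s ≤ exp (-(N : ℤ) + 2 * v + 6) := by
      have e : r₁ * (c R₁ - R₁) = (r₁ * (c R₁) + r₀) - (r₁ * R₁ + r₀) := by ring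
      have h := Valuation.map_sub_le _ hfcR₁ hfR₁
      rw [hf₂, hf₁, ← e, Valuation.map_mul, hsep] at h
      exact h
    have hr₁le : w.valuation F r₁ ≤ exp (-(N : ℤ) + 3 * v + 6) := by
      have h' : w.valuation F r₁ * exp (-(v : ℤ)) ≤ exp (-(N : ℤ) + 2 * v + 6) := by rw [← hsdef]; exact hr₁v
      refine (le_mul_exp_of_mul_exp_neg_le h').trans ?_
      rw [← exp_add, exp_le_exp]; omega
    have hr₀le : w.valuation F r₀ ≤ exp (-(N : ℤ) + 3 * v + 6) := by
      have e : r₀ = (r₁ * R₁ + r₀) - r₁ * R₁ := by ring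
      rw [e]
      refine Valuation.map_sub_le _ (by rw [← hf₁]; exact hfR₁.trans (by rw [exp_le_exp]; omega)) ?_
      rw [Valuation.map_mul]; exact mul_le_of_le_of_le_one hr₁le hR₁i
    have hSi : w.valuation F S ≤ 1 := by
      rw [hS, hpp]
      refine Valuation.map_sub_le _ (by rw [Valuation.map_neg]; exact hA) (Valuation.map_add_le _ hR₁i hcR₁i)
    rw [hfS]
    refine (Valuation.map_add_le _ ?_ (hr₀le.trans ?_))
    · rw [Valuation.map_mul]
      exact (mul_le_of_le_of_le_one hr₁le hSi).trans (by rw [exp_le_exp]; omega)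
    · rw [exp_le_exp]; omega
  · -- Sub-case (a): `c` fixes the class too — `R₂ = (R₁ + cR₁)/2` is rational
    set R₂ : F := (R₁ + c R₁) / 2 with hR₂
    have hcR₂ : c R₂ = R₂ := by rw [hR₂, map_div₀, map_add, hc2, map_ofNat]; ring
    have hτR₂ : τ R₂ = R₂ := by rw [hR₂, map_div₀, map_add, hτc', hτR₁, map_ofNat]
    obtain ⟨q, hq⟩ := hfix R₂ hτR₂ hcR₂
    refine ⟨q, ?_⟩
    have hqS : ((q : ℚ) : F) = R₂ := by rw [← hq]; rfl
    rw [hqS]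
    have hR₂R₁ : w.valuation F (R₂ - R₁) ≤ exp (-(N : ℤ) + 4 * v + 6) := by
      have e : R₂ - R₁ = (c R₁ - R₁) * (2 : F)⁻¹ := by rw [hR₂]; ring
      rw [e, Valuation.map_mul, Valuation.map_inv, h2, inv_one, mul_one]
      have h' : w.valuation F (c R₁ - R₁) * exp (-(2 * (v : ℤ))) ≤ exp (-(N : ℤ) + 2 * v + 6) := by
        rw [← hs2]; exact hnear
      refine (le_mul_exp_of_mul_exp_neg_le h').trans ?_
      rw [← exp_add, exp_le_exp]; omega
    have hR₂i : w.valuation F R₂ ≤ 1 := by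
      have e : R₂ = (R₂ - R₁) + R₁ := by ring
      rw [e]; refine Valuation.map_add_le _ (hR₂R₁.trans ?_) hR₁i
      rw [← exp_zero, exp_le_exp]; omega
    refine (val_eval_le_max w A B C hR₁i hR₂i).trans (max_le (hfR₁.trans ?_) hR₂R₁)
    rw [exp_le_exp]; omega

/-- **The orbit dichotomy.** For an integer cubic `f = x³ + Ax² + Bx + C` with `disc f = 3^v·U`,
`3 ∤ U`, `v` even, potentially good at the place `w ∋ 3` of a ninth cyclotomic field `F`, and an
algebraic integer `R ∈ 𝓞 F` with `w(f(R)) ≤ exp(−N)`, `N ≥ 8v + 8`: EITHER `U ≡ 1 (mod 3)`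
(principal series: the discriminant is a `3`-adic square) OR `f` has a RATIONAL approximate root of
precision `exp(−N + 4v + 6)`. [folklore] -/
theorem orbit_dichotomy (A B C : ℤ) (v : ℕ) (U : ℤ) (hv : Even v) (hU : ¬ (3 : ℤ) ∣ U)
    (hD : A ^ 2 * B ^ 2 - 4 * B ^ 3 - 4 * A ^ 3 * C - 27 * C ^ 2 + 18 * A * B * C = 3 ^ v * U)
    (hpg : w.valuation F (((A ^ 2 - 3 * B : ℤ) : F)) ^ 3 ≤ w.valuation F ((3 : F) ^ v * U))
    (R : 𝓞 F) (N : ℕ) (hN : 8 * v + 8 ≤ N)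
    (hR : w.valuation F ((R : F) ^ 3 + A * (R : F) ^ 2 + B * (R : F) + C) ≤ exp (-(N : ℤ))) :
    (3 : ℤ) ∣ U - 1 ∨ ∃ S : ℚ, w.valuation F ((S : F) ^ 3 + A * (S : F) ^ 2 + B * (S : F) + C) ≤
      exp (-(N : ℤ) + 4 * v + 6) := by
  haveI : Fact (Nat.Prime 3) := ⟨Nat.prime_three⟩
  obtain ⟨τ, c, hτ, hc, hτc, hfix⟩ := exists_generators_gal (F := F)
  set s : ℤᵐ⁰ := exp (-(v : ℤ)) with hsdef
  have hs2 : s ^ 2 = exp (-(2 * (v : ℤ))) := by rw [hsdef, ← exp_nsmul]; congr 1; ring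
  have hA := GNineCriterion.val_intCast_le w A
  have hB := GNineCriterion.val_intCast_le w B
  have hC := GNineCriterion.val_intCast_le w C
  have hRi : w.valuation F (R : F) ≤ 1 := valuation_le_one w R
  have h2 : w.valuation F (2 : F) = 1 := by
    exact_mod_cast GNine.val_natCast_eq_one_of_not_dvd w hw (D := 2) (by norm_num)
  have hDF : ((A : F) ^ 2 * (B : F) ^ 2 - 4 * (B : F) ^ 3 - 4 * (A : F) ^ 3 * C - 27 * (C : F) ^ 2 +
      18 * A * B * C) = (3 : F) ^ v * U := by exact_mod_cast congrArg (fun z : ℤ ↦ (z : F)) hD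
  have hvD : w.valuation F ((3 : F) ^ v * U) = exp (-(6 * (v : ℤ))) := by
    rw [Valuation.map_mul, val_three_pow w hw, GNine.val_intCast_eq_one_of_not_dvd w hw hU, mul_one]
  have hpg' : w.valuation F ((A : F) ^ 2 - 3 * B) ^ 3 ≤ w.valuation F ((A : F) ^ 2 * (B : F) ^ 2 -
      4 * (B : F) ^ 3 - 4 * (A : F) ^ 3 * C - 27 * (C : F) ^ 2 + 18 * A * B * C) := by
    rw [hDF]; push_cast at hpg; exact hpg
  have hRD : w.valuation F ((R : F) ^ 3 + A * (R : F) ^ 2 + B * (R : F) + C) < w.valuation F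
      ((A : F) ^ 2 * (B : F) ^ 2 - 4 * (B : F) ^ 3 - 4 * (A : F) ^ 3 * C - 27 * (C : F) ^ 2 +
      18 * A * B * C) := by
    rw [hDF, hvD]; exact lt_of_le_of_lt hR (by rw [exp_lt_exp]; omega)
  obtain ⟨h1, -, h3⟩ := val_deriv_pow_three_eq (v := w.valuation F) hA hB hC hRi h2 hpg' hRD
  rw [hDF, hvD] at h1
  have hb := eq_exp_of_pow_three_eq h1
  rw [hb] at h3
  have hb' : w.valuation F (3 * (R : F) ^ 2 + 2 * A * R + B) = s ^ 2 := by rw [hb, hs2]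
  have ha' : w.valuation F (3 * (R : F) + A) ≤ s := by rw [hsdef]; exact le_exp_of_sq_le h3
  have hfτ : w.valuation F ((τ (R : F)) ^ 3 + A * (τ (R : F)) ^ 2 + B * (τ (R : F)) + C) ≤
      exp (-(N : ℤ)) := by rw [val_eval_algEquiv w hw]; exact hR
  have hεs : exp (-(N : ℤ)) < s ^ 3 := by
    rw [hsdef, ← exp_nsmul, exp_lt_exp]; simp only [nsmul_eq_mul, Nat.cast_ofNat]; omega
  rcases dichotomy (v := w.valuation F) hb' ha' hR hfτ hεs with hfar | hclose
  · exact Or.inl (three_dvd_sub_one_of_far w hw A B C v U hv hD R N (by omega) hR τ hτ hfar)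
  · exact Or.inr (exists_rat_approx_root_of_close w hw A B C v U hU hD hpg R N hN hR τ c hτ hc hτc
      hfix hclose)

end Orbit

end Summit.BirchSwinnertonDyer.BirchSwinnertonDyer.Theorems.GNineConverse

end
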